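import Mathlib.Analysis.Calculus.MeanValue
import Mathlib.Order.Filter.Finite
import Literature.Analysis.ODE.MaximalTime
import Literature.Analysis.ODE.OneSidedComparison
import HarnessLib

/-!
# Passive enclosure: the face-slab (Müller) sub-step for a box of quiet modes

HONEST FRAMING: low prior, high value-of-information experiment on Tao's machine paradigm; NOT a
claim that NS blows up. Pure real analysis about finitely many scalar functions.

This is the soundness lemma of ONE sub-step of the passive certificates (P2)/(P0) of the toy delayed
threshold-gate chain (`R1-DESIGN.md` §8.3, `code/thgate/g19/passive19.py`, function `mstep`): a box
`[lo, hi]` of `n` modes at time `a` is propagated to time `b` by the affine bounds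
`hi i + (t - a) * S i`, `lo i + (t - a) * s i`, where `S i` (`s i`) bounds the `i`-th velocity from
above (below) whenever ALL modes lie in the a-priori box `[lo - g, hi + g]` and the `i`-th mode lies in
the upper (lower) FACE SLAB `[hi i - g i, hi i + g i]` (`[lo i - g i, lo i + g i]`), and the sub-step is
ACCEPTED only if `(b - a) * |S i| < g i` and `(b - a) * |s i| < g i` — so that the affine bound
functions never leave their slabs. Conclusion (`substep`): every family of continuous functions with
right derivatives obeying those velocity bounds and starting in `[lo, hi]` satisfies the affine bounds
on all of `[a, b]` (hence stays in the a-priori box, `substep_box`, and ends in the propagated box,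
`substep_end`). The proof is the continuity (bootstrap) argument on the maximal time of the bounds
(`Literature.Analysis.ODE.maximalTimeP`) combined with Mathlib's scalar fencing theorem
`image_le_of_deriv_right_lt_deriv_boundary'` applied to `ε`-tilted bounds.

References: W. Walter, *Differential and Integral Inequalities* (Springer, 1970), §II.12 (Müller's
theorem on quasi-bounds); the bootstrap form is folklore.
-/

noncomputable section

open Set Filter Topology

namespace Summit.NavierStokesRegularity.FluidComputer.PassiveEnclosure

open Literature.Analysis.ODE

/-- **Scalar upper fence with a face slab.** If `f a ≤ hi`, `f' ≤ S` whenever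
`hi - g ≤ f ≤ hi + g`, and `(b - a) |S| < g`, then `f x ≤ hi + (x - a) S` on `[a, b]`. [folklore] -/
theorem scalar_upper {f f' : ℝ → ℝ} {a b hi S g : ℝ} (hf : ContinuousOn f (Icc a b))
    (hf' : ∀ x ∈ Ico a b, HasDerivWithinAt f (f' x) (Ici x) x) (ha : f a ≤ hi)
    (hslab : ∀ x ∈ Ico a b, hi - g ≤ f x → f x ≤ hi + g → f' x ≤ S)
    (hg : (b - a) * |S| < g) : ∀ x ∈ Icc a b, f x ≤ hi + (x - a) * S := by
  intro x hx
  have hab : a ≤ b := hx.1.trans hx.2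
  -- room for the tilt
  set ε₀ : ℝ := (g - (b - a) * |S|) / (b - a + 1) with hε₀
  have hden : 0 < b - a + 1 := by linarith
  have hden' : b - a + 1 ≠ 0 := ne_of_gt hden
  have hε₀pos : 0 < ε₀ := div_pos (by linarith) hden
  have hroom : (b - a) * (|S| + ε₀) < g := by
    have h1 : (b - a) * ε₀ ≤ (b - a + 1) * ε₀ :=
      mul_le_mul_of_nonneg_right (by linarith) hε₀pos.le
    have h2 : (b - a + 1) * ε₀ = g - (b - a) * |S| := by
      rw [hε₀]; field_simp
    nlinarith
  -- the tilted fence for every small ε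
  have tilt : ∀ ε, 0 < ε → ε ≤ ε₀ → f x ≤ hi + (x - a) * (S + ε) := by
    intro ε hε hεle
    have hB : ContinuousOn (fun t => hi + (t - a) * (S + ε)) (Icc a b) := by fun_prop
    have hB' : ∀ t ∈ Ico a b,
        HasDerivWithinAt (fun t => hi + (t - a) * (S + ε)) (1 * (S + ε)) (Ici t) t := by
      intro t _
      exact (((hasDerivWithinAt_id t (Ici t)).sub_const a).mul_const (S + ε)).const_add hi
    have bound : ∀ t ∈ Ico a b, f t = hi + (t - a) * (S + ε) → f' t < 1 * (S + ε) := by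
      intro t ht heq
      have hta : 0 ≤ t - a := by linarith [ht.1]
      have htb : t - a ≤ b - a := by linarith [ht.2]
      have hlow : -((b - a) * (|S| + ε)) ≤ (t - a) * (S + ε) := by
        have : -( |S| + ε) ≤ S + ε := by linarith [neg_abs_le S]
        nlinarith [abs_nonneg S]
      have hup : (t - a) * (S + ε) ≤ (b - a) * (|S| + ε) := by
        have : S + ε ≤ |S| + ε := by linarith [le_abs_self S]
        nlinarith [abs_nonneg S]
      have hε' : (b - a) * (|S| + ε) ≤ (b - a) * (|S| + ε₀) :=
        mul_le_mul_of_nonneg_left (by linarith) (by linarith)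
      have h1 : hi - g ≤ f t := by rw [heq]; linarith
      have h2 : f t ≤ hi + g := by rw [heq]; linarith
      have := hslab t ht h1 h2
      linarith
    have ha' : f a ≤ hi + (a - a) * (S + ε) := by simpa using ha
    exact image_le_of_deriv_right_lt_deriv_boundary' hf hf' ha' hB hB' bound hx
  -- let ε → 0
  refine le_of_forall_pos_le_add fun δ hδ => ?_
  set ε : ℝ := min ε₀ (δ / (b - a + 1)) with hε
  have hεpos : 0 < ε := lt_min hε₀pos (div_pos hδ (by linarith))
  have hεle : ε ≤ ε₀ := min_le_left _ _
  have hεδ : (x - a) * ε ≤ δ := by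
    have h1 : (x - a) * ε ≤ (b - a + 1) * ε :=
      mul_le_mul_of_nonneg_right (by linarith [hx.2]) hεpos.le
    have h2 : (b - a + 1) * ε ≤ (b - a + 1) * (δ / (b - a + 1)) :=
      mul_le_mul_of_nonneg_left (min_le_right _ _) (by linarith)
    have h3 : (b - a + 1) * (δ / (b - a + 1)) = δ := by field_simp
    linarith
  have := tilt ε hεpos hεle
  nlinarith

/-- **Scalar lower fence with a face slab** (`scalar_upper` applied to `-f`). [folklore] -/
theorem scalar_lower {f f' : ℝ → ℝ} {a b lo s g : ℝ} (hf : ContinuousOn f (Icc a b))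
    (hf' : ∀ x ∈ Ico a b, HasDerivWithinAt f (f' x) (Ici x) x) (ha : lo ≤ f a)
    (hslab : ∀ x ∈ Ico a b, lo - g ≤ f x → f x ≤ lo + g → s ≤ f' x)
    (hg : (b - a) * |s| < g) : ∀ x ∈ Icc a b, lo + (x - a) * s ≤ f x := by
  intro x hx
  have h := scalar_upper (f := fun t => -f t) (f' := fun t => -f' t) (hi := -lo) (S := -s) (g := g)
    hf.neg (fun t ht => (hf' t ht).neg) (by simpa using ha)
    (fun t ht h1 h2 => by
      have := hslab t ht (by linarith) (by linarith)
      linarith)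
    (by simpa [abs_neg] using hg) x hx
  have hxs : (x - a) * -s = -((x - a) * s) := by ring
  linarith

variable {n : ℕ}

/-- **The accepted sub-step is sound** (Müller face-slab enclosure, bootstrap form). Modes
`y · i`, continuous on `[a, b]` with right derivatives `dy · i`; start box `[lo, hi]`; a-priori box
`[lo - g, hi + g]`; velocity bounds `S i` / `s i` valid whenever all modes are in the a-priori box and
mode `i` is in its upper / lower face slab; acceptance `(b - a)|S i| < g i`, `(b - a)|s i| < g i`.
Then the affine bounds hold on `[a, b]`. [folklore] -/
theorem substep {y dy : ℝ → Fin n → ℝ} {a b : ℝ} {lo hi g S s : Fin n → ℝ} (hab : a ≤ b)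
    (hcont : ∀ i, ContinuousOn (fun t => y t i) (Icc a b))
    (hder : ∀ i, ∀ t ∈ Ico a b, HasDerivWithinAt (fun t => y t i) (dy t i) (Ici t) t)
    (h0 : ∀ i, lo i ≤ y a i ∧ y a i ≤ hi i)
    (hS : ∀ t ∈ Ico a b, (∀ j, lo j - g j ≤ y t j ∧ y t j ≤ hi j + g j) →
      ∀ i, hi i - g i ≤ y t i → dy t i ≤ S i)
    (hs : ∀ t ∈ Ico a b, (∀ j, lo j - g j ≤ y t j ∧ y t j ≤ hi j + g j) →
      ∀ i, y t i ≤ lo i + g i → s i ≤ dy t i)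
    (hgS : ∀ i, (b - a) * |S i| < g i) (hgs : ∀ i, (b - a) * |s i| < g i) :
    ∀ t ∈ Icc a b, ∀ i, lo i + (t - a) * s i ≤ y t i ∧ y t i ≤ hi i + (t - a) * S i := by
  -- the bootstrapped property
  let P : ℝ → Prop := fun t => ∀ i, lo i + (t - a) * s i ≤ y t i ∧ y t i ≤ hi i + (t - a) * S i
  have hPa : P a := fun i => by simpa using h0 i
  -- (1) if the a-priori box holds on `[a, c]`, the affine bounds hold on `[a, c]`
  have key : ∀ c, c ≤ b → (∀ t ∈ Icc a c, ∀ j, lo j - g j ≤ y t j ∧ y t j ≤ hi j + g j) →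
      ∀ t ∈ Icc a c, P t := by
    intro c hcb hbox t ht i
    have hf : ContinuousOn (fun t => y t i) (Icc a c) := (hcont i).mono (Icc_subset_Icc_right hcb)
    have hf' : ∀ x ∈ Ico a c, HasDerivWithinAt (fun t => y t i) (dy x i) (Ici x) x :=
      fun x hx => hder i x ⟨hx.1, hx.2.trans_le hcb⟩
    have hca : c - a ≤ b - a := by linarith
    have hgS' : (c - a) * |S i| < g i :=
      lt_of_le_of_lt (mul_le_mul_of_nonneg_right hca (abs_nonneg _)) (hgS i)
    have hgs' : (c - a) * |s i| < g i :=
      lt_of_le_of_lt (mul_le_mul_of_nonneg_right hca (abs_nonneg _)) (hgs i)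
    refine ⟨?_, ?_⟩
    · exact scalar_lower hf hf' (h0 i).1
        (fun x hx _ h2 => hs x ⟨hx.1, hx.2.trans_le hcb⟩ (hbox x ⟨hx.1, hx.2.le⟩) i h2) hgs' t ht
    · exact scalar_upper hf hf' (h0 i).2
        (fun x hx h1 _ => hS x ⟨hx.1, hx.2.trans_le hcb⟩ (hbox x ⟨hx.1, hx.2.le⟩) i h1) hgS' t ht
  -- (2) the affine bounds put the state STRICTLY inside the a-priori box
  have box_of_P : ∀ t ∈ Icc a b, P t → ∀ j, lo j - g j < y t j ∧ y t j < hi j + g j := by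
    intro t ht hP j
    obtain ⟨h1, h2⟩ := hP j
    have hta : 0 ≤ t - a := by linarith [ht.1]
    have htb : t - a ≤ b - a := by linarith [ht.2]
    have hu : (t - a) * S j ≤ (b - a) * |S j| := by
      have : S j ≤ |S j| := le_abs_self _
      nlinarith [abs_nonneg (S j)]
    have hl : -((b - a) * |s j|) ≤ (t - a) * s j := by
      have : -|s j| ≤ s j := neg_abs_le _
      nlinarith [abs_nonneg (s j)]
    have := hgS j; have := hgs j
    constructor <;> linarith
  -- (3) `P` is closed under limits from the left
  have hclosed : ∀ t ∈ Ioc a b, (∀ u ∈ Ico a t, P u) → P t := by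
    intro t ht hP i
    have hc1 : ContinuousOn (fun u => lo i + (u - a) * s i - y u i) (Icc a b) :=
      ((continuousOn_const).add
        ((continuousOn_id.sub continuousOn_const).mul continuousOn_const)).sub (hcont i)
    have hc2 : ContinuousOn (fun u => y u i - (hi i + (u - a) * S i)) (Icc a b) :=
      (hcont i).sub ((continuousOn_const).add
        ((continuousOn_id.sub continuousOn_const).mul continuousOn_const))
    have e1 := le_const_of_forall_Ico (C := 0) hc1 ht (fun u hu => by have := (hP u hu i).1; linarith)
    have e2 := le_const_of_forall_Ico (C := 0) hc2 ht (fun u hu => by have := (hP u hu i).2; linarith)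
    constructor <;> linarith
  -- (4) bootstrap on the maximal time of `P`
  have hTmem : maximalTimeP P a b ∈ Icc a b := maximalTimeP_mem hab hPa
  have hPT : ∀ t ∈ Icc a (maximalTimeP P a b), P t :=
    fun t ht => maximalTimeP_spec hab hPa hclosed ht
  have hTb : maximalTimeP P a b = b := by
    by_contra hne
    have hTlt : maximalTimeP P a b < b := lt_of_le_of_ne hTmem.2 hne
    have hstrict := box_of_P _ hTmem (hPT _ ⟨hTmem.1, le_rfl⟩)
    have hev : ∀ᶠ t in 𝓝[Icc a b] (maximalTimeP P a b),
        ∀ j, lo j - g j ≤ y t j ∧ y t j ≤ hi j + g j := by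
      rw [Filter.eventually_all]
      intro j
      have hc : ContinuousWithinAt (fun t => y t j) (Icc a b) (maximalTimeP P a b) :=
        hcont j _ hTmem
      obtain ⟨h1, h2⟩ := hstrict j
      exact (hc.tendsto.eventually_mem (Ioo_mem_nhds h1 h2)).mono fun t ht => ⟨ht.1.le, ht.2.le⟩
    rw [eventually_nhdsWithin_iff, Metric.eventually_nhds_iff] at hev
    obtain ⟨δ, hδ, hδP⟩ := hev
    set c := min b (maximalTimeP P a b + δ / 2) with hc
    have hTc : maximalTimeP P a b < c := lt_min hTlt (by linarith)
    have hcb : c ≤ b := min_le_left _ _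
    have hboxc : ∀ t ∈ Icc a c, ∀ j, lo j - g j ≤ y t j ∧ y t j ≤ hi j + g j := by
      intro t ht j
      rcases le_or_gt t (maximalTimeP P a b) with h | h
      · have hb := box_of_P t ⟨ht.1, h.trans hTmem.2⟩ (hPT t ⟨ht.1, h⟩) j
        exact ⟨hb.1.le, hb.2.le⟩
      · have htb : t ∈ Icc a b := ⟨ht.1, ht.2.trans hcb⟩
        have hdist : dist t (maximalTimeP P a b) < δ := by
          rw [Real.dist_eq, abs_of_nonneg (by linarith)]
          have : t ≤ maximalTimeP P a b + δ / 2 := ht.2.trans (min_le_right _ _)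
          linarith
        exact hδP hdist htb j
    have hPc : ∀ t ∈ Icc a c, P t := key c hcb hboxc
    have hle : c ≤ maximalTimeP P a b := le_maximalTimeP ⟨hTmem.1.trans hTc.le, hcb⟩ hPc
    linarith
  intro t ht
  exact hPT t ⟨ht.1, hTb.symm ▸ ht.2⟩

/-- The state stays in the a-priori box `[lo - g, hi + g]` during the accepted sub-step. [folklore] -/
theorem substep_box {y dy : ℝ → Fin n → ℝ} {a b : ℝ} {lo hi g S s : Fin n → ℝ} (hab : a ≤ b)
    (hcont : ∀ i, ContinuousOn (fun t => y t i) (Icc a b))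
    (hder : ∀ i, ∀ t ∈ Ico a b, HasDerivWithinAt (fun t => y t i) (dy t i) (Ici t) t)
    (h0 : ∀ i, lo i ≤ y a i ∧ y a i ≤ hi i)
    (hS : ∀ t ∈ Ico a b, (∀ j, lo j - g j ≤ y t j ∧ y t j ≤ hi j + g j) →
      ∀ i, hi i - g i ≤ y t i → dy t i ≤ S i)
    (hs : ∀ t ∈ Ico a b, (∀ j, lo j - g j ≤ y t j ∧ y t j ≤ hi j + g j) →
      ∀ i, y t i ≤ lo i + g i → s i ≤ dy t i)
    (hgS : ∀ i, (b - a) * |S i| < g i) (hgs : ∀ i, (b - a) * |s i| < g i) :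
    ∀ t ∈ Icc a b, ∀ i, lo i - g i ≤ y t i ∧ y t i ≤ hi i + g i := by
  intro t ht i
  obtain ⟨h1, h2⟩ := substep hab hcont hder h0 hS hs hgS hgs t ht i
  have hta : 0 ≤ t - a := by linarith [ht.1]
  have htb : t - a ≤ b - a := by linarith [ht.2]
  have hu : (t - a) * S i ≤ (b - a) * |S i| := by
    have : S i ≤ |S i| := le_abs_self _
    nlinarith [abs_nonneg (S i)]
  have hl : -((b - a) * |s i|) ≤ (t - a) * s i := by
    have : -|s i| ≤ s i := neg_abs_le _
    nlinarith [abs_nonneg (s i)]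
  have := hgS i; have := hgs i
  constructor <;> linarith

/-- The propagated box at the end of the accepted sub-step:
`lo i + (b - a) s i ≤ y b i ≤ hi i + (b - a) S i`; any outward-rounded `nlo ≤ lo + (b - a) s`,
`hi + (b - a) S ≤ nhi` (as the kernel twin computes them) is then a valid start box for the next
sub-step. [folklore] -/
theorem substep_end {y dy : ℝ → Fin n → ℝ} {a b : ℝ} {lo hi g S s nlo nhi : Fin n → ℝ}
    (hab : a ≤ b)
    (hcont : ∀ i, ContinuousOn (fun t => y t i) (Icc a b))
    (hder : ∀ i, ∀ t ∈ Ico a b, HasDerivWithinAt (fun t => y t i) (dy t i) (Ici t) t)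
    (h0 : ∀ i, lo i ≤ y a i ∧ y a i ≤ hi i)
    (hS : ∀ t ∈ Ico a b, (∀ j, lo j - g j ≤ y t j ∧ y t j ≤ hi j + g j) →
      ∀ i, hi i - g i ≤ y t i → dy t i ≤ S i)
    (hs : ∀ t ∈ Ico a b, (∀ j, lo j - g j ≤ y t j ∧ y t j ≤ hi j + g j) →
      ∀ i, y t i ≤ lo i + g i → s i ≤ dy t i)
    (hgS : ∀ i, (b - a) * |S i| < g i) (hgs : ∀ i, (b - a) * |s i| < g i)
    (hnlo : ∀ i, nlo i ≤ lo i + (b - a) * s i) (hnhi : ∀ i, hi i + (b - a) * S i ≤ nhi i) :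
    ∀ i, nlo i ≤ y b i ∧ y b i ≤ nhi i := by
  intro i
  obtain ⟨h1, h2⟩ := substep hab hcont hder h0 hS hs hgS hgs b ⟨hab, le_rfl⟩ i
  exact ⟨(hnlo i).trans h1, h2.trans (hnhi i)⟩

end Summit.NavierStokesRegularity.FluidComputer.PassiveEnclosure
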